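import Summits.ValiantsHypothesis.ValiantsHypothesis.Theorems.KPlusLogSqLawTropicalBCrossingChains
import Summits.ValiantsHypothesis.ValiantsHypothesis.Theorems.KPlusLogSqLawTropicalBBandedPolynomial

/-!
# Route «KPlusLogSqLaw», crux `TropicalB` (stmt-ValiantsHypothesis-19771) — BANDED CHAINS ARE POLYNOMIALLY SHORT IN EVERY DESIGN:
# a dominant chain whose permutations all have bandwidth `≤ u` has `n + 1 ≤ (mK+1)·2^{(4u+1)(⌊log₂ m⌋+1)} ≤ (mK+1)·(2m)^{4u+1}`

HONEST FRAMING.  Helper toward the registered stubs `stub_tropThin` / `stub_tropFat` of `Cruxes/TropicalB/Lines/birth.lean` (crux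
`Summit.ValiantsHypothesis.ValiantsHypothesis.Theses.KPlusLogSqLaw.TropicalB`, item stmt-ValiantsHypothesis-19771, route KPlusLogSqLaw,
DRAFT; cell `pub-symmetroid`, seat val-sym-trop-p1 g7, 2026-08-27; `--supports … --as helper`).  A STRUCTURE theorem about dominant
chains of ARBITRARY designs; nothing here bounds `TropicalB` for general chains or bears on `TropicalB` in its window, `WeakLifting`,
DoorA26 / DoorA34, `MatrixDescartes` (stmt-ValiantsHypothesis-18050) or VP ≠ VNP.

THE POINT.  The two-sided banded sector theorem (`IntervalOpt.chain_le_banded`, seat val-sym-trop-p5: supports with `|a − b| ≤ u` carry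
fewer than `(mK+1)·(2m)^{4u+1}` chain terms — POLYNOMIAL) only uses the `≤ 16^u` band shapes of the images `σ([a, t))` of the CHAIN'S
OWN permutations (`image_mem_bandShapes`).  Through the predicate form of the state-count recursion (`chain_le_of_states_pred`,
…TropicalBCrossingChains) it therefore holds chain by chain in ANY design:

* `chain_le_of_banded_terms` — in any design of format `(m, K)`, a dominant chain (strictly increasing integer slopes, distinct
  consecutive terms) all of whose permutations satisfy `|σ_k(i) − i| ≤ u` has `n + 1 ≤ (mK+1)·2^{(4u+1)(⌊log₂ m⌋+1)}`;
* `chain_lt_poly_of_banded_terms` — hence `n < (mK+1)·(2m)^{4u+1}` (`m ≥ 1`): polynomial in `m` for fixed `u`, no `log² m`;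
* `exists_displacement_of_long_chain` — contrapositive for the construction side: a chain with `n + 1 > (mK+1)·2^{(4u+1)(⌊log₂ m⌋+1)}`
  contains a term displacing some column by more than `u` (`σ_k(i) > i + u` or `i > σ_k(i) + u`); with the tree's relabelling
  invariance: under EVERY simultaneous choice of a row order and a column order, super-polynomial chains use far-displacing permutations
  (registers that «rotate», as SHIFT-THREE's `finRotate` phases do, are forced).

Companion of `crossing_chain_le_two_pow` (…TropicalBCrossingChains: one-sided crossing bound `w` ⇒ the `K + log² m` shape with
`C = 20w + 8`) and of the visited-image law (…TropicalBVisitedImages).  [folklore: bounded-width transfer matrices; Gusfield 1980]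
-/

set_option linter.dupNamespace false
set_option autoImplicit false

namespace Summit.ValiantsHypothesis.ValiantsHypothesis.Theorems.KPlusLogSqLaw

open Summit.ValiantsHypothesis.ValiantsHypothesis.Theorems.MatrixDescartes.Negative
open Summit.ValiantsHypothesis.ValiantsHypothesis.Theorems.LacunarySymmetroidMatrixDescartes
open scoped BigOperators
open Finset

namespace IntervalOpt

variable {m K : ℕ} {d : Fin K → ℕ} {v ε : Fin m → Fin m → Fin K → ℤ}

/-- **BANDED CHAINS ARE POLYNOMIALLY SHORT.**  In ANY design of format `(m, K)`, a dominant chain with distinct consecutive terms all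
of whose permutations have bandwidth `≤ u` (`σ_k(i) ≤ i + u` and `i ≤ σ_k(i) + u` for all `k, i`) has
`n + 1 ≤ (mK+1)·2^{(4u+1)(⌊log₂ m⌋+1)}`. [folklore] -/
theorem chain_le_of_banded_terms {u n : ℕ} (θ : Fin (n + 1) → ℤ) (p : Fin (n + 1) → Equiv.Perm (Fin m) × (Fin m → Fin K))
    (hθ : StrictMono θ) (hdom : ∀ k, IsDominant d v ε (θ k) (p k)) (hne : ∀ k : Fin n, p k.castSucc ≠ p k.succ)
    (hband : ∀ (k : Fin (n + 1)) (i : Fin m),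
      (((p k).1 i : Fin m) : ℕ) ≤ (i : ℕ) + u ∧ (i : ℕ) ≤ (((p k).1 i : Fin m) : ℕ) + u) :
    n + 1 ≤ (m * K + 1) * 2 ^ ((4 * u + 1) * (Nat.log 2 m + 1)) := by
  have h := chain_le_of_states_pred (d := d) (v := v) (ε := ε)
    (fun q => ∀ i : Fin m, ((q.1 i : Fin m) : ℕ) ≤ (i : ℕ) + u ∧ (i : ℕ) ≤ ((q.1 i : Fin m) : ℕ) + u)
    (bandShapes m u) (2 ^ (2 * u) * 2 ^ (2 * u)) (Nat.one_le_iff_ne_zero.2 (by positivity)) (fun a t => card_bandShapes_le u a t)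
    (fun _ _ hq a t => image_mem_bandShapes hq a t) θ p hθ hdom hne hband
  have he : 2 * (2 ^ (2 * u) * 2 ^ (2 * u)) = 2 ^ (4 * u + 1) := by
    rw [← pow_add, ← pow_succ']; ring_nf
  rw [he, ← pow_mul] at h
  exact h

/-- **explicit degree**: for `m ≥ 1`, a chain of `u`-banded permutations in any design of format `(m, K)` has `n < (mK+1)·(2m)^{4u+1}`.
[folklore] -/
theorem chain_lt_poly_of_banded_terms {u n : ℕ} (hm : 1 ≤ m) (θ : Fin (n + 1) → ℤ)
    (p : Fin (n + 1) → Equiv.Perm (Fin m) × (Fin m → Fin K))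
    (hθ : StrictMono θ) (hdom : ∀ k, IsDominant d v ε (θ k) (p k)) (hne : ∀ k : Fin n, p k.castSucc ≠ p k.succ)
    (hband : ∀ (k : Fin (n + 1)) (i : Fin m),
      (((p k).1 i : Fin m) : ℕ) ≤ (i : ℕ) + u ∧ (i : ℕ) ≤ (((p k).1 i : Fin m) : ℕ) + u) :
    n < (m * K + 1) * (2 * m) ^ (4 * u + 1) := by
  have h := chain_le_of_banded_terms (d := d) (v := v) (ε := ε) θ p hθ hdom hne hband
  have hL : 2 ^ (Nat.log 2 m + 1) ≤ 2 * m := by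
    rw [pow_succ]
    have := Nat.pow_log_le_self 2 (by omega : m ≠ 0)
    omega
  have h2 : 2 ^ ((4 * u + 1) * (Nat.log 2 m + 1)) ≤ (2 * m) ^ (4 * u + 1) := by
    rw [mul_comm, pow_mul]
    exact Nat.pow_le_pow_left hL _
  have h3 := Nat.mul_le_mul_left (m * K + 1) h2
  omega

/-- **Contrapositive: super-polynomial chains displace.**  In any design, a dominant chain with
`(mK+1)·2^{(4u+1)(⌊log₂ m⌋+1)} < n + 1` contains a term whose permutation moves some column by more than `u`
(`σ_k(i) > i + u` or `i > σ_k(i) + u`). [folklore] -/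
theorem exists_displacement_of_long_chain (u : ℕ) (d : Fin K → ℕ) (v ε : Fin m → Fin m → Fin K → ℤ) {n : ℕ}
    (θ : Fin (n + 1) → ℤ) (p : Fin (n + 1) → Equiv.Perm (Fin m) × (Fin m → Fin K))
    (hθ : StrictMono θ) (hdom : ∀ k, IsDominant d v ε (θ k) (p k)) (hne : ∀ k : Fin n, p k.castSucc ≠ p k.succ)
    (hn : (m * K + 1) * 2 ^ ((4 * u + 1) * (Nat.log 2 m + 1)) < n + 1) :
    ∃ (k : Fin (n + 1)) (i : Fin m), (i : ℕ) + u < (((p k).1 i : Fin m) : ℕ) ∨ (((p k).1 i : Fin m) : ℕ) + u < (i : ℕ) := by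
  by_contra h
  push Not at h
  have hband : ∀ (k : Fin (n + 1)) (i : Fin m),
      (((p k).1 i : Fin m) : ℕ) ≤ (i : ℕ) + u ∧ (i : ℕ) ≤ (((p k).1 i : Fin m) : ℕ) + u := fun k i => h k i
  exact absurd (chain_le_of_banded_terms (d := d) (v := v) (ε := ε) θ p hθ hdom hne hband) (not_le.mpr hn)

end IntervalOpt

open IntervalOpt in
/-- **BANDED CHAINS ARE POLYNOMIALLY SHORT (crux currency).**  For every `u`, ALL `m ≥ 1`, `K` and EVERY design of format `(m, K)`: a
sign-alternating chain of dominant terms at strictly increasing integer slopes whose permutations all have bandwidth `≤ u` has fewer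
than `(mK+1)·(2m)^{4u+1}` sign changes — polynomial in `m`, no support hypothesis. [folklore] -/
theorem tropicalB_banded_chains (u : ℕ) : ∀ (m K : ℕ) (d : Fin K → ℕ) (v ε : Fin m → Fin m → Fin K → ℤ) (n : ℕ)
    (θ : Fin (n + 1) → ℤ) (p : Fin (n + 1) → Equiv.Perm (Fin m) × (Fin m → Fin K)), 1 ≤ m →
    (∀ (k : Fin (n + 1)) (i : Fin m), (((p k).1 i : Fin m) : ℕ) ≤ (i : ℕ) + u ∧ (i : ℕ) ≤ (((p k).1 i : Fin m) : ℕ) + u) →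
    (∀ i j l, (ε i j l).natAbs ≤ 1) → StrictMono θ →
    (∀ k, IsDominant d v ε (θ k) (p k)) → (∀ k : Fin n, termSign ε (p k.castSucc) * termSign ε (p k.succ) < 0) →
    n < (m * K + 1) * (2 * m) ^ (4 * u + 1) :=
  fun _ _ d v ε _ θ p hm hband _ hθ hdom halt =>
    chain_lt_poly_of_banded_terms (d := d) (v := v) (ε := ε) hm θ p hθ hdom (ne_succ_of_alternating ε p halt) hband

end Summit.ValiantsHypothesis.ValiantsHypothesis.Theorems.KPlusLogSqLaw
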